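import Summits.NavierStokesRegularity.NavierStokesRegularity.Theorems.ExtremiserTransienceNearExtremalTransienceExtremiserLiouvilleConstantSpeedSlideGenerator
import HarnessLib

/-!
# Crux `ExtremiserTransience.NearExtremalTransience` (stmt-NavierStokesRegularity-21883), line `extremiser_liouville`,
# stub K1b — THE TRUNCATED (general-profile) PIOLA SLIDE: admissible up to a first-order speed excess `|Dg(V_h)|`

`--supports stmt-NavierStokesRegularity-21883` (helper).  Author: prover seat `ns-el-k1b` (g8).  Record:
`Cruxes/NearExtremalTransience/Lines/extremiser_liouville_k1b_slide.md` §10 (F0) — the FLAT alternative needs slides whose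
profile `g : ℝ³ → ℝ` is also cut off horizontally (`g = g₁(x₂)χ_R(x_h)`).  For a general `g ∈ C²` the Piola transform of `V`
under `Φ(x) = x − g(x)e₂` is
```
  Ṽ(x) = (1 − ∂₂g(x))·V(Φx) + Dg(x)(V(Φx))·e₂ .
```
* `divergence_comp_genSlideMap` : `div(V∘Φ)(x) = div V(Φx) − Dg(x)(∂₂V(Φx))`;
* `isDivFree_truncatedSlide` : **`div Ṽ = 0`** for `div V = 0` (symmetry of `D²g`);
* `norm_add_truncatedSlide_le` : **`‖c + Ṽ(x)‖ ≤ ‖c‖ + |Dg(x)(V_h(Φx))|`** whenever `0 ≤ ∂₂g ≤ 2` and `⟪V, c⟫ ≡ −‖V‖²/2`,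
  `c = (0,0,c₂)`: the speed excess is FIRST ORDER but carries the HORIZONTAL gradient of the profile only — for `g = εg₁(x₂)χ(x_h/R)`
  it is `≤ ε‖g₁‖_∞‖∇χ‖_∞ σ(R)/R`, so g5's `firstVariation_le_of_norm_add_le_global` costs `κ⋆²MZW·η` with `η → 0` as `R → ∞`.
(The axial case `g = g(x₂)` is `…ConstantSpeedPiolaSlide`, where the excess vanishes identically.)

WHAT THIS IS NOT: K1b is NOT proved; nothing here proves NS regularity. [folklore]
-/

noncomputable section

open Set Filter Topology MeasureTheory Metric Function InnerProductSpace
open scoped ENNReal NNReal Topology InnerProductSpace RealInnerProductSpace ContDiff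
open Literature.Analysis.FluidPDE Literature.Analysis

namespace Summit.NavierStokesRegularity.NavierStokesRegularity.Theorems

-- the problem directory repeats the summit name (`NavierStokesRegularity/NavierStokesRegularity`)
set_option linter.dupNamespace false

namespace ExtremiserLiouville

open DepletionLadder.KStar

variable {V : EuclideanSpace ℝ (Fin 3) → EuclideanSpace ℝ (Fin 3)} {c : EuclideanSpace ℝ (Fin 3)} {g : EuclideanSpace ℝ (Fin 3) → ℝ}

/-! ## 1. The general slide map `Φ(x) = x − g(x)e₂` -/

/-- Derivative of the general slide map: `DΦ(x)v = v − Dg(x)v·e₂`. [folklore] -/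
theorem hasFDerivAt_genSlideMap (hg : Differentiable ℝ g) (x : EuclideanSpace ℝ (Fin 3)) :
    HasFDerivAt (fun y : EuclideanSpace ℝ (Fin 3) => y - g y • EuclideanSpace.single (2 : Fin 3) (1 : ℝ))
      (ContinuousLinearMap.id ℝ (EuclideanSpace ℝ (Fin 3)) - (fderiv ℝ g x).smulRight (EuclideanSpace.single (2 : Fin 3) (1 : ℝ))) x := by
  have h1 : HasFDerivAt (fun y : EuclideanSpace ℝ (Fin 3) => g y • EuclideanSpace.single (2 : Fin 3) (1 : ℝ))
      ((fderiv ℝ g x).smulRight (EuclideanSpace.single (2 : Fin 3) (1 : ℝ))) x := (hg x).hasFDerivAt.smul_const _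
  exact (hasFDerivAt_id x).sub h1

/-- **Chain rule for the divergence along the general slide map**: `div(V∘Φ)(x) = div V(Φx) − Dg(x)(∂₂V(Φx))`. [folklore] -/
theorem divergence_comp_genSlideMap (hV : Differentiable ℝ V) (hg : Differentiable ℝ g) (x : EuclideanSpace ℝ (Fin 3)) :
    VectorCalculus.divergence (fun y : EuclideanSpace ℝ (Fin 3) => V (y - g y • EuclideanSpace.single (2 : Fin 3) (1 : ℝ))) x =
      VectorCalculus.divergence V (x - g x • EuclideanSpace.single (2 : Fin 3) (1 : ℝ)) -
        fderiv ℝ g x (fderiv ℝ V (x - g x • EuclideanSpace.single (2 : Fin 3) (1 : ℝ)) (EuclideanSpace.single (2 : Fin 3) (1 : ℝ))) := by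
  set e₂ : EuclideanSpace ℝ (Fin 3) := EuclideanSpace.single (2 : Fin 3) (1 : ℝ) with he₂
  set Φ : EuclideanSpace ℝ (Fin 3) → EuclideanSpace ℝ (Fin 3) := fun y => y - g y • e₂ with hΦ
  have hΦD : HasFDerivAt Φ (ContinuousLinearMap.id ℝ _ - (fderiv ℝ g x).smulRight e₂) x := hasFDerivAt_genSlideMap hg x
  have hcomp : HasFDerivAt (fun y => V (Φ y)) ((fderiv ℝ V (Φ x)).comp (ContinuousLinearMap.id ℝ _ - (fderiv ℝ g x).smulRight e₂)) x :=
    (hV (Φ x)).hasFDerivAt.comp x hΦD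
  have hcol : ∀ i : Fin 3, fderiv ℝ (fun y => V (Φ y)) x (EuclideanSpace.single i 1) =
      fderiv ℝ V (Φ x) (EuclideanSpace.single i 1) - fderiv ℝ g x (EuclideanSpace.single i 1) • fderiv ℝ V (Φ x) e₂ := by
    intro i
    rw [hcomp.fderiv, ContinuousLinearMap.comp_apply]
    show fderiv ℝ V (Φ x) (EuclideanSpace.single i 1 - (fderiv ℝ g x (EuclideanSpace.single i 1)) • e₂) = _
    rw [map_sub, map_smul]
  -- a covector through the standard basis: `ℓ u = Σᵢ uᵢ ℓ(eᵢ)` (cf. `PowerGaugeEulerLiouville.WeakEulerian.dual_apply_coord`)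
  have hsum : ∀ (ℓ : EuclideanSpace ℝ (Fin 3) →L[ℝ] ℝ) (u : EuclideanSpace ℝ (Fin 3)),
      ℓ u = u 0 * ℓ (EuclideanSpace.single 0 1) + u 1 * ℓ (EuclideanSpace.single 1 1) + u 2 * ℓ (EuclideanSpace.single 2 1) := by
    intro ℓ u
    have hu : u = (u 0) • EuclideanSpace.single (0 : Fin 3) (1 : ℝ) + (u 1) • EuclideanSpace.single (1 : Fin 3) (1 : ℝ) +
        (u 2) • EuclideanSpace.single (2 : Fin 3) (1 : ℝ) := by
      ext i; fin_cases i <;> simp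
    conv_lhs => rw [hu]
    rw [map_add, map_add, map_smul, map_smul, map_smul, smul_eq_mul, smul_eq_mul, smul_eq_mul]
  rw [divergence_eq_sum_three, divergence_eq_sum_three, hcol 0, hcol 1, hcol 2, hsum (fderiv ℝ g x) (fderiv ℝ V (Φ x) e₂)]
  simp only [PiLp.sub_apply, PiLp.smul_apply, smul_eq_mul]
  ring

/-! ## 2. The truncated slide is divergence free -/

/-- **The general Piola slide is divergence free**: for `V ∈ C¹` with `div V = 0` and `g ∈ C²`,
`div( (1 − ∂₂g)·V∘Φ + Dg(V∘Φ)·e₂ ) = 0`, `Φ(x) = x − g(x)e₂`. [folklore] -/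
theorem isDivFree_truncatedSlide (hV : ContDiff ℝ 1 V) (hdiv : VectorCalculus.IsDivFree V) (hg : ContDiff ℝ 2 g) :
    VectorCalculus.IsDivFree fun x : EuclideanSpace ℝ (Fin 3) =>
      (1 - fderiv ℝ g x (EuclideanSpace.single (2 : Fin 3) (1 : ℝ))) • V (x - g x • EuclideanSpace.single (2 : Fin 3) (1 : ℝ)) +
        (fderiv ℝ g x (V (x - g x • EuclideanSpace.single (2 : Fin 3) (1 : ℝ)))) • EuclideanSpace.single (2 : Fin 3) (1 : ℝ) := by
  set e₂ : EuclideanSpace ℝ (Fin 3) := EuclideanSpace.single (2 : Fin 3) (1 : ℝ) with he₂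
  set Φ : EuclideanSpace ℝ (Fin 3) → EuclideanSpace ℝ (Fin 3) := fun y => y - g y • e₂ with hΦ
  have hVd : Differentiable ℝ V := hV.differentiable one_ne_zero
  have hgd : Differentiable ℝ g := hg.differentiable two_ne_zero
  have hΦd : Differentiable ℝ Φ := fun y => (hasFDerivAt_genSlideMap hgd y).differentiableAt
  set U : EuclideanSpace ℝ (Fin 3) → EuclideanSpace ℝ (Fin 3) := fun y => V (Φ y) with hU
  have hUd : Differentiable ℝ U := hVd.comp hΦd
  -- `a = 1 − ∂₂g`, `r = Dg(U)`
  have hDg : ∀ y, HasFDerivAt (fderiv ℝ g) (fderiv ℝ (fderiv ℝ g) y) y := fun y =>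
    (((hg.fderiv_right (m := 1) (by norm_num)).differentiable one_ne_zero) y).hasFDerivAt
  set a : EuclideanSpace ℝ (Fin 3) → ℝ := fun y => 1 - fderiv ℝ g y e₂ with ha
  have haD : ∀ y, HasFDerivAt a (-((fderiv ℝ (fderiv ℝ g) y).flip e₂)) y := by
    intro y
    have h1 : HasFDerivAt (fun z => fderiv ℝ g z e₂) ((fderiv ℝ (fderiv ℝ g) y).flip e₂) y := by
      have := (hDg y).clm_apply (hasFDerivAt_const e₂ y)
      simpa using this
    have h2 : HasFDerivAt (fun z => (1 : ℝ) - fderiv ℝ g z e₂) (0 - (fderiv ℝ (fderiv ℝ g) y).flip e₂) y :=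
      (hasFDerivAt_const (1 : ℝ) y).sub h1
    rw [zero_sub] at h2
    exact h2
  have had : Differentiable ℝ a := fun y => (haD y).differentiableAt
  set r : EuclideanSpace ℝ (Fin 3) → ℝ := fun y => fderiv ℝ g y (U y) with hr
  have hrD : ∀ y, HasFDerivAt r ((fderiv ℝ g y).comp (fderiv ℝ U y) + (fderiv ℝ (fderiv ℝ g) y).flip (U y)) y := fun y =>
    (hDg y).clm_apply (hUd y).hasFDerivAt
  have hrd : Differentiable ℝ r := fun y => (hrD y).differentiableAt
  intro x
  have hsplit : (fun y : EuclideanSpace ℝ (Fin 3) => (1 - fderiv ℝ g y e₂) • V (y - g y • e₂) + (fderiv ℝ g y (V (y - g y • e₂))) • e₂) =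
      fun y => a y • U y + (1 : ℝ) • (r y • e₂) := by
    funext y; simp only [ha, hU, hr, hΦ, one_smul]
  have h1d : Differentiable ℝ (fun y => a y • U y) := had.smul hUd
  have h2d : Differentiable ℝ (fun y => r y • e₂) := hrd.smul_const e₂
  rw [hsplit, divergence_add_smul h1d h2d, one_mul,
    Literature.Analysis.FluidPDE.divergence_smul_apply (had x) (hUd x),
    Literature.Analysis.FluidPDE.divergence_smul_apply (hrd x) (differentiableAt_const e₂)]
  have hdivconst : VectorCalculus.divergence (fun _ : EuclideanSpace ℝ (Fin 3) => e₂) x = 0 := by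
    rw [divergence_eq_sum_three]; simp
  -- `div U = −Dg(P)` with `P = ∂₂V∘Φ`
  have hdivU : VectorCalculus.divergence U x = -(fderiv ℝ g x (fderiv ℝ V (Φ x) e₂)) := by
    have h := divergence_comp_genSlideMap hVd hgd x
    rw [hdiv (Φ x), zero_sub] at h
    exact h
  -- `DU e₂ = (1 − ∂₂g) P`
  have hDUe2 : fderiv ℝ U x e₂ = (1 - fderiv ℝ g x e₂) • fderiv ℝ V (Φ x) e₂ := by
    have hcomp : HasFDerivAt U ((fderiv ℝ V (Φ x)).comp (ContinuousLinearMap.id ℝ _ - (fderiv ℝ g x).smulRight e₂)) x :=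
      (hVd (Φ x)).hasFDerivAt.comp x (hasFDerivAt_genSlideMap hgd x)
    rw [hcomp.fderiv, ContinuousLinearMap.comp_apply]
    show fderiv ℝ V (Φ x) (e₂ - (fderiv ℝ g x e₂) • e₂) = _
    rw [map_sub, map_smul, sub_smul, one_smul]
  -- the two gradient pairings
  have hga : ⟪U x, gradient a x⟫ = -(fderiv ℝ (fderiv ℝ g) x (U x) e₂) := by
    rw [real_inner_comm, gradient, InnerProductSpace.toDual_symm_apply, (haD x).fderiv]
    simp [ContinuousLinearMap.flip_apply]
  have hgr : ⟪e₂, gradient r x⟫ = fderiv ℝ g x (fderiv ℝ U x e₂) + fderiv ℝ (fderiv ℝ g) x e₂ (U x) := by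
    rw [real_inner_comm, gradient, InnerProductSpace.toDual_symm_apply, (hrD x).fderiv]
    simp [ContinuousLinearMap.flip_apply]
  have hsymm : fderiv ℝ (fderiv ℝ g) x e₂ (U x) = fderiv ℝ (fderiv ℝ g) x (U x) e₂ :=
    (hg.contDiffAt.isSymmSndFDerivAt (by simp)) e₂ (U x)
  rw [hdivconst, mul_zero, zero_add, hdivU, hga, hgr, hDUe2, hsymm, map_smul, smul_eq_mul]
  simp only [ha]
  ring

/-! ## 3. The speed excess is the horizontal part of the profile gradient -/

/-- Algebra: if `⟪y,c⟫ = −‖y‖²/2`, `c = (0,0,c₂)`, `t² ≤ 1`, then for every `s`: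
`‖c + (t·y + (s + (1−t)y₂)·e₂)‖ ≤ ‖c‖ + |s|` (`t·y + (s + (1−t)y₂)e₂ = (t·y_h, y₂ + s)`; `(c₂+y₂)² + ‖y_h‖² = c₂²`). [folklore] -/
theorem norm_add_genScale_le (hc0 : c 0 = 0) (hc1 : c 1 = 0) {y : EuclideanSpace ℝ (Fin 3)}
    (hy : ⟪y, c⟫ = -(‖y‖ ^ 2 / 2)) {t : ℝ} (ht : t ^ 2 ≤ 1) (s : ℝ) :
    ‖c + (t • y + (s + (1 - t) * y 2) • EuclideanSpace.single (2 : Fin 3) (1 : ℝ))‖ ≤ ‖c‖ + |s| := by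
  have hny : ‖y‖ ^ 2 = y 0 ^ 2 + y 1 ^ 2 + y 2 ^ 2 := by rw [EuclideanSpace.real_norm_sq_eq, Fin.sum_univ_three]
  have hnc2 : ‖c‖ ^ 2 = c 2 ^ 2 := by rw [EuclideanSpace.real_norm_sq_eq, Fin.sum_univ_three, hc0, hc1]; ring
  have hnc : ‖c‖ = |c 2| := by
    rw [← Real.sqrt_sq (norm_nonneg c), hnc2, Real.sqrt_sq_eq_abs]
  have hyc : ⟪y, c⟫ = y 2 * c 2 := by
    simp only [PiLp.inner_apply, RCLike.inner_apply, conj_trivial, Fin.sum_univ_three, hc0, hc1]; ring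
  rw [hyc, hny] at hy
  set z : EuclideanSpace ℝ (Fin 3) := c + (t • y + (s + (1 - t) * y 2) • EuclideanSpace.single (2 : Fin 3) (1 : ℝ)) with hz
  have hz0 : z 0 = t * y 0 := by simp [hz, hc0]
  have hz1 : z 1 = t * y 1 := by simp [hz, hc1]
  have hz2 : z 2 = c 2 + y 2 + s := by simp [hz]; ring
  have hnz : ‖z‖ ^ 2 = z 0 ^ 2 + z 1 ^ 2 + z 2 ^ 2 := by rw [EuclideanSpace.real_norm_sq_eq, Fin.sum_univ_three]
  -- `(c₂ + y₂)² + y₀² + y₁² = c₂²`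
  have key : (c 2 + y 2) ^ 2 + (y 0 ^ 2 + y 1 ^ 2) = c 2 ^ 2 := by
    have e : (c 2 + y 2) ^ 2 + (y 0 ^ 2 + y 1 ^ 2) = c 2 ^ 2 + (2 * (y 2 * c 2) + (y 0 ^ 2 + y 1 ^ 2 + y 2 ^ 2)) := by ring
    rw [e, hy]; ring
  have hw2 : |c 2 + y 2| ≤ |c 2| := by
    rw [← Real.sqrt_sq_eq_abs, ← Real.sqrt_sq_eq_abs]
    exact Real.sqrt_le_sqrt (by linarith [key, sq_nonneg (y 0), sq_nonneg (y 1)])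
  have hsq : ‖z‖ ^ 2 ≤ (‖c‖ + |s|) ^ 2 := by
    rw [hnz, hz0, hz1, hz2, hnc]
    have hA : (t * y 0) ^ 2 + (t * y 1) ^ 2 ≤ c 2 ^ 2 - (c 2 + y 2) ^ 2 := by
      have h1 : 0 ≤ (1 - t ^ 2) * (y 0 ^ 2 + y 1 ^ 2) :=
        mul_nonneg (sub_nonneg.2 ht) (add_nonneg (sq_nonneg _) (sq_nonneg _))
      have e1 : c 2 ^ 2 - (c 2 + y 2) ^ 2 = y 0 ^ 2 + y 1 ^ 2 := by linarith [key]
      have e2 : (t * y 0) ^ 2 + (t * y 1) ^ 2 = (y 0 ^ 2 + y 1 ^ 2) - (1 - t ^ 2) * (y 0 ^ 2 + y 1 ^ 2) := by ring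
      rw [e1, e2]
      linarith [h1]
    have hB : (c 2 + y 2 + s) ^ 2 ≤ (c 2 + y 2) ^ 2 + 2 * |c 2| * |s| + s ^ 2 := by
      have h1 : (c 2 + y 2) * s ≤ |c 2 + y 2| * |s| := by rw [← abs_mul]; exact le_abs_self _
      have h2 : |c 2 + y 2| * |s| ≤ |c 2| * |s| := mul_le_mul_of_nonneg_right hw2 (abs_nonneg s)
      have e : (c 2 + y 2 + s) ^ 2 = (c 2 + y 2) ^ 2 + 2 * ((c 2 + y 2) * s) + s ^ 2 := by ring
      rw [e]
      linarith [h1, h2]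
    have hC : (|c 2| + |s|) ^ 2 = c 2 ^ 2 + 2 * |c 2| * |s| + s ^ 2 := by
      rw [add_sq, sq_abs, sq_abs]
    rw [hC]
    linarith [hA, hB]
  have hpos : 0 ≤ ‖c‖ + |s| := by positivity
  exact (pow_le_pow_iff_left₀ (norm_nonneg z) hpos two_ne_zero).1 hsq

/-- **The speed of the truncated slide**: for the residue deviation `V` (`⟪V, c⟫ ≡ −‖V‖²/2`, `c = (0,0,c₂)`) and a profile with
`0 ≤ ∂₂g ≤ 2`: `‖c + Ṽ(x)‖ ≤ ‖c‖ + |Dg(x)(V_h(Φx))|`, `V_h = V − V₂e₂`. [folklore] -/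
theorem norm_add_truncatedSlide_le (hc0 : c 0 = 0) (hc1 : c 1 = 0) (hVc : ∀ y, ⟪V y, c⟫ = -(‖V y‖ ^ 2 / 2))
    (x : EuclideanSpace ℝ (Fin 3)) (h0 : 0 ≤ fderiv ℝ g x (EuclideanSpace.single (2 : Fin 3) (1 : ℝ)))
    (h2 : fderiv ℝ g x (EuclideanSpace.single (2 : Fin 3) (1 : ℝ)) ≤ 2) :
    ‖c + ((1 - fderiv ℝ g x (EuclideanSpace.single (2 : Fin 3) (1 : ℝ))) • V (x - g x • EuclideanSpace.single (2 : Fin 3) (1 : ℝ)) +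
        (fderiv ℝ g x (V (x - g x • EuclideanSpace.single (2 : Fin 3) (1 : ℝ)))) • EuclideanSpace.single (2 : Fin 3) (1 : ℝ))‖ ≤
      ‖c‖ + |fderiv ℝ g x (V (x - g x • EuclideanSpace.single (2 : Fin 3) (1 : ℝ)) -
        (V (x - g x • EuclideanSpace.single (2 : Fin 3) (1 : ℝ)) 2) • EuclideanSpace.single (2 : Fin 3) (1 : ℝ))| := by
  set e₂ : EuclideanSpace ℝ (Fin 3) := EuclideanSpace.single (2 : Fin 3) (1 : ℝ) with he₂
  set y := V (x - g x • e₂) with hy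
  set t : ℝ := 1 - fderiv ℝ g x e₂ with ht
  set s : ℝ := fderiv ℝ g x (y - (y 2) • e₂) with hs
  have ht2 : t ^ 2 ≤ 1 := by rw [ht]; nlinarith
  have hrew : (1 - fderiv ℝ g x e₂) • y + (fderiv ℝ g x y) • e₂ = t • y + (s + (1 - t) * y 2) • e₂ := by
    rw [hs, ht, map_sub, map_smul, smul_eq_mul]
    congr 1
    ring_nf
  rw [hrew]
  exact norm_add_genScale_le hc0 hc1 (hVc _) ht2 s

end ExtremiserLiouville

end Summit.NavierStokesRegularity.NavierStokesRegularity.Theorems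

end
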